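import Mathlib
import Literature.AlgebraicGeometry.Resolution.BranchContactOrderTransport
import Literature.AlgebraicGeometry.Resolution.ReducedQuadraticTransformBranches
import Literature.AlgebraicGeometry.Resolution.BlowupPointSubalgebra
import HarnessLib

/-!
# The potential of Krull's blow-up tower of a one-dimensional reduced local ring

Topic: `Literature/AlgebraicGeometry/Resolution`. The numerical invariant that bounds Krull's /
Kollár's blow-up tower (Kollár 2007, Alg. 1.100 / Thm. 1.101; Krull 1930, Satz 7) of a
one-dimensional REDUCED Noetherian local ring `R`, branch by branch: for each minimal prime `q`,
the `δ`-invariant `δ(R/q)` of the branch (`CurveDeltaInvariant.lean`), and for each ordered pair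
of distinct minimal primes `q ≠ q'` the contact order of the image of `q'` along the branch
`θ_q(R) ≅ R/q ⊆ Frac(R/q)` (`BranchContactOrder.lean`):

  `towerPotential R = Σ_q δ(R/q) + Σ_{q ≠ q'} contactOrder(θ_q(R), θ_q(q'))` (in `ℕ∞`).

This file: the definitions (`branchDelta`, `branchContact`, `towerPotential`) and their
**invariance under ring isomorphisms** (`branchDelta_comap`, `branchContact_comap`,
`towerPotential_eq_of_ringEquiv`). The one-step drop along a local quadratic transform and the
discharge of `Kollar2007_thm_1_101_localChain` are in `OneDimensionalBlowupTowerProof.lean`.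
All PROVED; the three definitions are numerical invariants (no named facts).

## Sources

* J. Kollár, *Lectures on Resolution of Singularities*, Ann. of Math. Stud. 166 (2007), §1.4,
  Alg. 1.100, Thm. 1.101. [Kollar2007]
-/

noncomputable section

open IsLocalRing

namespace Literature.AlgebraicGeometry.Resolution

universe u

variable (R : Type u) [CommRing R]

/-! ## Definitions -/

open Classical in
/-- `δ(R/q)`: the `δ`-invariant of the branch `V(q)` (`0` if `q` is not prime). [cite: Kollar2007, §1.4] -/
def branchDelta (q : Ideal R) : ℕ∞ :=
  if hq : q.IsPrime then
    haveI := hq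
    curveDelta (R ⧸ q) (FractionRing (R ⧸ q))
  else 0

open Classical in
/-- The contact order of (the image of) `q'` along the branch `θ_q(R) ≅ R/q ⊆ Frac(R/q)`
(`0` if `q` is not prime). [cite: Kollar2007, §1.4] -/
def branchContact (q q' : Ideal R) : ℕ∞ :=
  if hq : q.IsPrime then
    haveI := hq
    contactOrder (branchPoint q).range (branchPoint q '' (q' : Set R))
  else 0

open Classical in
/-- **The tower potential** `Σ_q δ(R/q) + Σ_{q ≠ q'} contactOrder(θ_q(R), θ_q(q'))` over the
minimal primes of `R` (`⊤` if there are infinitely many). [cite: Kollar2007, Alg. 1.100, Thm. 1.101] -/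
def towerPotential : ℕ∞ :=
  if h : (minimalPrimes R).Finite then
    ∑ q ∈ h.toFinset, (branchDelta R q + ∑ q' ∈ h.toFinset.erase q, branchContact R q q')
  else ⊤

variable {R}

/-- Unfolding `branchDelta` at a prime. [cite: Kollar2007, §1.4] -/
theorem branchDelta_eq (q : Ideal R) [hq : q.IsPrime] :
    branchDelta R q = curveDelta (R ⧸ q) (FractionRing (R ⧸ q)) := by
  classical
  rw [branchDelta, dif_pos hq]

/-- Unfolding `branchContact` at a prime. [cite: Kollar2007, §1.4] -/
theorem branchContact_eq (q q' : Ideal R) [hq : q.IsPrime] :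
    branchContact R q q' = contactOrder (branchPoint q).range (branchPoint q '' (q' : Set R)) := by
  classical
  rw [branchContact, dif_pos hq]

/-- Unfolding `towerPotential` when the minimal primes are finite in number.
[cite: Kollar2007, §1.4] -/
theorem towerPotential_eq (h : (minimalPrimes R).Finite) :
    towerPotential R =
      ∑ q ∈ h.toFinset, (branchDelta R q + ∑ q' ∈ h.toFinset.erase q, branchContact R q q') := by
  classical
  rw [towerPotential, dif_pos h]

/-! ## Invariance under ring isomorphisms -/

section Transport

variable {S : Type u} [CommRing S] (e : R ≃+* S)

/-- Minimal primes correspond under a ring isomorphism: `minimalPrimes R = comap e '' minimalPrimes S`.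
[cite: Kollar2007, §1.4] -/
theorem minimalPrimes_eq_image_comap :
    minimalPrimes R = Ideal.comap (e : R →+* S) '' minimalPrimes S := by
  have h := Ideal.comap_minimalPrimes_eq_of_surjective (f := (e : R →+* S)) e.surjective ⊥
  have hbot : (⊥ : Ideal S).comap (e : R →+* S) = ⊥ := by
    rw [← RingHom.ker_eq_comap_bot]
    exact (RingHom.injective_iff_ker_eq_bot _).mp e.injective
  rw [hbot] at h
  exact h

/-- The induced isomorphism of branches `R/comap q ≃ S/q`. [cite: Kollar2007, §1.4] -/
def branchEquiv (q : Ideal S) : R ⧸ q.comap (e : R →+* S) ≃+* S ⧸ q :=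
  Ideal.quotientEquiv (q.comap (e : R →+* S)) q e
    (by rw [Ideal.map_comap_of_surjective (e : R →+* S) e.surjective])

/-- **`δ` of corresponding branches agree.** [cite: Kollar2007, §1.4] -/
theorem branchDelta_comap (q : Ideal S) [hq : q.IsPrime] :
    branchDelta R (q.comap (e : R →+* S)) = branchDelta S q := by
  haveI : (q.comap (e : R →+* S)).IsPrime := Ideal.comap_isPrime _ _
  rw [branchDelta_eq, branchDelta_eq]
  exact curveDelta_eq_of_ringEquiv (branchEquiv e q) _ _

/-- **Contact orders of corresponding branches agree.** [cite: Kollar2007, §1.4] -/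
theorem branchContact_comap (q q' : Ideal S) [hq : q.IsPrime] :
    branchContact R (q.comap (e : R →+* S)) (q'.comap (e : R →+* S)) = branchContact S q q' := by
  haveI hp : (q.comap (e : R →+* S)).IsPrime := Ideal.comap_isPrime _ _
  rw [branchContact_eq, branchContact_eq]
  -- the isomorphism of branch fraction fields
  let ε := branchEquiv e q
  let E : FractionRing (R ⧸ q.comap (e : R →+* S)) ≃+* FractionRing (S ⧸ q) :=
    IsFractionRing.ringEquivOfRingEquiv ε
  have hE : ∀ r : R, E (branchPoint (q.comap (e : R →+* S)) r) = branchPoint q (e r) := by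
    intro r
    have h1 : branchPoint (q.comap (e : R →+* S)) r =
        algebraMap _ (FractionRing (R ⧸ q.comap (e : R →+* S)))
          (Ideal.Quotient.mk (q.comap (e : R →+* S)) r) := rfl
    have h2 : branchPoint q (e r) = algebraMap _ (FractionRing (S ⧸ q)) (Ideal.Quotient.mk q (e r)) :=
      rfl
    rw [h1, h2, IsFractionRing.ringEquivOfRingEquiv_algebraMap]
    exact congrArg _ (Ideal.quotientEquiv_mk _ _ e _ r)
  have h1 : ((branchPoint (q.comap (e : R →+* S))).range).map (E : _ →+* _) = (branchPoint q).range := by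
    ext x
    constructor
    · rintro ⟨_, ⟨r, rfl⟩, rfl⟩
      exact ⟨e r, (hE r).symm⟩
    · rintro ⟨s, rfl⟩
      exact ⟨branchPoint _ (e.symm s), ⟨e.symm s, rfl⟩, by
        change E _ = _; rw [hE, e.apply_symm_apply]⟩
  have h2 : E '' (branchPoint (q.comap (e : R →+* S)) '' (q'.comap (e : R →+* S) : Set R)) =
      branchPoint q '' (q' : Set S) := by
    ext x
    constructor
    · rintro ⟨_, ⟨r, hr, rfl⟩, rfl⟩
      exact ⟨e r, hr, (hE r).symm⟩
    · rintro ⟨s, hs, rfl⟩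
      refine ⟨branchPoint _ (e.symm s), ⟨e.symm s, ?_, rfl⟩, by rw [hE, e.apply_symm_apply]⟩
      change (e : R →+* S) (e.symm s) ∈ q'
      rw [RingEquiv.coe_toRingHom, e.apply_symm_apply]; exact hs
  rw [← contactOrder_map_ringEquiv E, h1, h2]

include e in
/-- **The tower potential is invariant under ring isomorphisms.** [cite: Kollar2007, §1.4] -/
theorem towerPotential_eq_of_ringEquiv : towerPotential R = towerPotential S := by
  classical
  by_cases hS : (minimalPrimes S).Finite
  · have hR : (minimalPrimes R).Finite := by
      rw [minimalPrimes_eq_image_comap e]; exact hS.image _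
    rw [towerPotential_eq hR, towerPotential_eq hS]
    -- reindex along `q ↦ comap e q`
    have hinj : Function.Injective (Ideal.comap (e : R →+* S)) :=
      Ideal.comap_injective_of_surjective _ e.surjective
    have hF : hR.toFinset = hS.toFinset.image (Ideal.comap (e : R →+* S)) := by
      ext q
      rw [Set.Finite.mem_toFinset, Finset.mem_image, minimalPrimes_eq_image_comap e]
      simp only [Set.mem_image, Set.Finite.mem_toFinset]
    rw [hF, Finset.sum_image fun a _ b _ h => hinj h]
    refine Finset.sum_congr rfl fun q hq => ?_
    haveI : q.IsPrime := ((Set.Finite.mem_toFinset _).mp hq).1.1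
    rw [branchDelta_comap e q, ← Finset.image_erase hinj, Finset.sum_image fun a _ b _ h => hinj h]
    congr 1
    refine Finset.sum_congr rfl fun q' _ => ?_
    exact branchContact_comap e q q'
  · have hR : ¬ (minimalPrimes R).Finite := fun hR => hS (by
      have := hR.image (Ideal.map (e : R →+* S))
      refine this.subset ?_
      intro q hq
      refine ⟨q.comap (e : R →+* S), ?_, Ideal.map_comap_of_surjective _ e.surjective _⟩
      rw [minimalPrimes_eq_image_comap e]; exact ⟨q, hq, rfl⟩)
    classical
    rw [towerPotential, towerPotential, dif_neg hR, dif_neg hS]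

end Transport

end Literature.AlgebraicGeometry.Resolution
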